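import Summits.Ventures.YMGap.FlowData.TubeTransferOperator
import HarnessLib

/-!
# Venture YMGap, track Y3 FLOW-DATA — GAUGE INVARIANCE of the tube transfer operator: `T ∘ G_γ = T = G_γ ∘ T`
# for every gauge transformation `γ` of the slice (theorems only)

HONEST FRAMING: venture file of the cell `pub-ymgap` (QuantumFields programme), track Y3; companion THEOREMS for
`FlowData/TubeTransferOperator.lean` (lead R237 (c)).  The docstrings there say «the temporal links are
Haar-integrated = the Gauss-law projection, so no gauge is fixed and the operator vanishes on the orthogonal
complement of the gauge-invariant functions»; this file makes it a theorem.  For a gauge transformation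
`γ : sites → G` of the slice, `U ↦ U^γ` (tree `gaugeTransform`, measure preserving), let `G_γ ψ = ψ ∘ (·)^γ` be the
induced isometry of `L²` (written inline as `Lp.compMeasurePreservingₗᵢ`).  Then the slice kernel is invariant in
EACH argument separately (`sliceKernel_gaugeTransform_right/left`: the temporal-link integral absorbs `γ` by the
right-invariance of Haar measure; unitary `ρ` for the left slot via the symmetry of the kernel), hence
**`tubeTransferOperator_comp_gaugeOp : T ∘ G_γ = T`** and **`gaugeOp_comp_tubeTransferOperator : G_γ ∘ T = T`** — `T`
factors through the gauge average on both sides (FLOW-PLAN §1.2's «acting on gauge-invariant L²»).  Finite spatial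
torus; no number, no row, nothing about limits or a mass gap.

References: M. Lüscher, Commun. Math. Phys. 54 (1977) 283 [cite: Luscher1977]; E. Seiler, LNP 159 (1982) Ch. 2
[cite: MontvayMunster1994, §3.2.6 (3.137)–(3.146)].
-/

noncomputable section

open scoped BigOperators ENNReal
open MeasureTheory Filter Function
open Literature.MathematicalPhysics.QuantumFieldTheory Literature.Analysis.OperatorTheory

namespace Summit.Ventures.YMGap.FlowData

section Algebra

variable {G : Type*} [Group G] {n k L : ℕ} [NeZero L] (ρ : G →* Matrix (Fin n) (Fin n) ℂ)

/-- **Spatial plaquettes are gauge invariant**: `magSum (U^γ) = magSum U` (from the tree's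
`wilsonAction_gaugeTransform` and `wilsonAction = const − magSum`). [folklore] -/
theorem magSum_gaugeTransform (γ : Site k L → G) (U : GaugeConfig k L G) :
    magSum (d := k) (L := L) ρ (gaugeTransform γ U) = magSum (d := k) (L := L) ρ U := by
  have h1 := wilsonAction_eq_const_sub_magSum ρ (gaugeTransform γ U)
  have h2 := wilsonAction_eq_const_sub_magSum ρ U
  have h3 := wilsonAction_gaugeTransform ρ γ U
  linarith

/-- A gauge transformation of the LATER slice is a right translation of the temporal links:
`elecSum(a, E, b^γ) = elecSum(a, E·γ, b)`. [folklore] -/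
theorem elecSum_gaugeTransform_right (γ : Site k L → G) (a b : GaugeConfig k L G) (E : Site k L → G) :
    elecSum (d := k) (L := L) ρ a E (gaugeTransform γ b) = elecSum (d := k) (L := L) ρ a (E * γ) b := by
  unfold elecSum
  refine Finset.sum_congr rfl fun x _ => Finset.sum_congr rfl fun i _ => ?_
  simp only [gaugeTransform, Site.shift, Pi.mul_apply, mul_inv_rev, mul_assoc]

end Algebra

section Kernel

variable {G : Type*} [Group G] [TopologicalSpace G] [IsTopologicalGroup G] [CompactSpace G]
  [MeasurableSpace G] [BorelSpace G] {n k L : ℕ} [NeZero L] (ρ : G →* Matrix (Fin n) (Fin n) ℂ)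

/-- **The slice kernel is invariant under a gauge transformation of its second argument**:
`K(a, b^γ) = K(a, b)` (right-invariance of the Haar integral over the temporal links). [cite: Luscher1977] -/
theorem sliceKernel_gaugeTransform_right (γ : Site k L → G) (JE JM : ℝ) (a b : GaugeConfig k L G) :
    sliceKernel (d := k) (L := L) ρ JE JM a (gaugeTransform γ b) = sliceKernel (d := k) (L := L) ρ JE JM a b := by
  unfold sliceKernel
  rw [magSum_gaugeTransform]
  simp_rw [elecSum_gaugeTransform_right]
  rw [integral_mul_right_eq_self (fun E : Site k L → G => Real.exp (JE * elecSum (d := k) (L := L) ρ a E b)) γ]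

/-- **… and of its first argument** (unitary `ρ`, by the symmetry of the kernel): `K(a^γ, b) = K(a, b)`.
[cite: Luscher1977] -/
theorem sliceKernel_gaugeTransform_left (hρu : ∀ g, ρ g ∈ Matrix.unitaryGroup (Fin n) ℂ) (γ : Site k L → G)
    (JE JM : ℝ) (a b : GaugeConfig k L G) :
    sliceKernel (d := k) (L := L) ρ JE JM (gaugeTransform γ a) b = sliceKernel (d := k) (L := L) ρ JE JM a b := by
  rw [sliceKernel_symm (d := k) (L := L) ρ hρu, sliceKernel_gaugeTransform_right, sliceKernel_symm (d := k) (L := L) ρ hρu]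

end Kernel

section Operator

variable {G : Type*} [Group G] [TopologicalSpace G] [IsTopologicalGroup G] [CompactSpace G]
  [MeasurableSpace G] [BorelSpace G] [SecondCountableTopology G] {n : ℕ} (ρ : G →* Matrix (Fin n) (Fin n) ℂ)
  (J : ℝ) {k L : ℕ} [NeZero L]

/-- **`T ∘ G_γ = T`**: the tube transfer operator annihilates the orthogonal complement of the gauge-invariant
functions — applying `T` after pulling back by any gauge transformation changes nothing (continuous `ρ`).
[cite: Luscher1977] [cite: MontvayMunster1994, §3.2.6 (3.137)–(3.146)] -/
theorem tubeTransferOperator_comp_gaugeOp (hρ : Continuous ρ) (γ : Site k L → G) :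
    (tubeTransferOperator ρ J k L).comp
        (Lp.compMeasurePreservingₗᵢ ℝ (gaugeTransform γ : GaugeConfig k L G → GaugeConfig k L G)
          (WilsonGauge.measurePreserving_gaugeTransform γ)).toContinuousLinearMap =
      tubeTransferOperator ρ J k L := by
  set μ : Measure (GaugeConfig k L G) := sliceMeasure G k L with hμ
  set K : GaugeConfig k L G → GaugeConfig k L G → ℝ := sliceKernel (d := k) (L := L) ρ J J with hK
  have hmp : MeasurePreserving (gaugeTransform γ : GaugeConfig k L G → GaugeConfig k L G) μ μ :=
    WilsonGauge.measurePreserving_gaugeTransform γ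
  have hKc : Continuous (uncurry K) := continuous_sliceKernel (d := k) (L := L) ρ hρ J J
  refine ContinuousLinearMap.ext fun φ => Lp.ext ?_
  rw [ContinuousLinearMap.comp_apply]
  have hcs : ((Lp.compMeasurePreservingₗᵢ ℝ (gaugeTransform γ : GaugeConfig k L G → GaugeConfig k L G) hmp)
      |>.toContinuousLinearMap φ : GaugeConfig k L G → ℝ) =ᵐ[μ] (φ : GaugeConfig k L G → ℝ) ∘ gaugeTransform γ :=
    Lp.coeFn_compMeasurePreserving φ hmp
  refine (tubeTransferOperator_ae_eq J k L hρ _).trans ((tubeTransferOperator_ae_eq J k L hρ φ).trans ?_).symm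
  refine Eventually.of_forall fun a => ?_
  -- `∫ K a b φ b = ∫ K a b (φ ∘ γ) b`
  have h1 : ∫ b, K a b * ((Lp.compMeasurePreservingₗᵢ ℝ
        (gaugeTransform γ : GaugeConfig k L G → GaugeConfig k L G) hmp).toContinuousLinearMap φ :
          GaugeConfig k L G → ℝ) b ∂μ = ∫ b, K a b * φ (gaugeTransform γ b) ∂μ := by
    refine integral_congr_ae ?_
    filter_upwards [hcs] with b hb
    rw [hb, Function.comp_apply]
  have h2 : ∫ b, K a b * φ (gaugeTransform γ b) ∂μ =
      ∫ b, (fun c => K a c * φ c) (gaugeTransform γ b) ∂μ := by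
    refine integral_congr_ae (Eventually.of_forall fun b => ?_)
    simp only [hK, sliceKernel_gaugeTransform_right]
  have hg : AEStronglyMeasurable (fun c => K a c * φ c) μ :=
    ((hKc.comp (Continuous.prodMk continuous_const continuous_id)).aestronglyMeasurable).mul
      (Lp.aestronglyMeasurable φ)
  have h3 : ∫ b, (fun c => K a c * φ c) (gaugeTransform γ b) ∂μ = ∫ c, K a c * φ c ∂μ := by
    have hg' : AEStronglyMeasurable (fun c => K a c * φ c)
        (Measure.map (gaugeTransform γ : GaugeConfig k L G → GaugeConfig k L G) μ) := by rw [hmp.map_eq]; exact hg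
    have := integral_map hmp.measurable.aemeasurable hg'
    rw [hmp.map_eq] at this
    exact this.symm
  dsimp only
  rw [h1, h2, h3]

/-- **`G_γ ∘ T = T`**: the image of `T` consists of gauge-invariant functions — `(Tφ) ∘ (·)^γ = Tφ` in `L²`
(continuous unitary `ρ`). [cite: Luscher1977] [cite: MontvayMunster1994, §3.2.6 (3.137)–(3.146)] -/
theorem gaugeOp_comp_tubeTransferOperator (hρ : Continuous ρ) (hρu : ∀ g, ρ g ∈ Matrix.unitaryGroup (Fin n) ℂ)
    (γ : Site k L → G) :
    (Lp.compMeasurePreservingₗᵢ ℝ (gaugeTransform γ : GaugeConfig k L G → GaugeConfig k L G)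
          (WilsonGauge.measurePreserving_gaugeTransform γ)).toContinuousLinearMap.comp
        (tubeTransferOperator ρ J k L) = tubeTransferOperator ρ J k L := by
  set μ : Measure (GaugeConfig k L G) := sliceMeasure G k L with hμ
  have hmp : MeasurePreserving (gaugeTransform γ : GaugeConfig k L G → GaugeConfig k L G) μ μ :=
    WilsonGauge.measurePreserving_gaugeTransform γ
  refine ContinuousLinearMap.ext fun φ => Lp.ext ?_
  rw [ContinuousLinearMap.comp_apply]
  refine (Lp.coeFn_compMeasurePreserving _ hmp).trans ?_
  refine (hmp.quasiMeasurePreserving.ae_eq_comp (tubeTransferOperator_ae_eq J k L hρ φ)).trans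
    ((tubeTransferOperator_ae_eq J k L hρ φ).trans ?_).symm
  refine Eventually.of_forall fun a => ?_
  simp only [Function.comp_apply, sliceKernel_gaugeTransform_left ρ hρu]

end Operator

end Summit.Ventures.YMGap.FlowData
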